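import Mathlib
import Summits.Ventures.DiscreteObjects.Mahler.CensusAuxCutsVerdict

/-!
# Leaf thresholds from certified auxiliary-function cuts (venture `DiscreteObjects`, target L)

Cell `pub-namedobj`, seat `pub-namedobj-mahler-g15`. Framing: lottery ticket; floor = certified bounds/negative
ranges.

The kernel search `censusSearchC T CT d [] []` tests the power sums `P_k`, `d < k ≤ |T|`, of every leaf against the thresholds
`T_k`; so far `T_k` had to dominate the elementary bound `2d - 2 + B^k + B^{-k}` (`ThresholdsValid`).  This file allows a
threshold to be justified INSTEAD by a pair of certified explicit-auxiliary-function cuts `P_k ≥ -N⁺`, `-P_k ≥ -N⁻` with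
`N⁺, N⁻ ≤ T_k` (`CutValidAL d k B (±e_k, N^±)` of `CensusAuxiliaryLog`, any `k`, also `k > d`): `ThresholdsValidX`.  The search,
the certificate checker and the verdict chain are unchanged: `take_descCoeffList_mem_censusSearchC_of_irreducibleXT`,
`census_verdict_nonnegXT`, `degreeCensus_of_certified_nonnegXT`.  Motivation (measured at degree 18): the survivors that
need a Graeffe certificate have `M ≈ 1.4 … 3` and pass the elementary leaf test only through cancelling power sums; half of
them fail a threshold tightened by `≈ 10` at some `k ∈ [10, 14]`, which certified cuts provide.
-/

namespace Summit.Ventures.DiscreteObjects.Mahler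

open Polynomial

/-- The unit functional `e_k = [1, 0, …, 0]` (length `k`, table format `[a_k, …, a_1]`: coefficient of `P_k` first). -/
def unitCut (k : ℕ) : List ℤ := 1 :: List.replicate (k - 1) 0

/-- The functional `-e_k`. -/
def negUnitCut (k : ℕ) : List ℤ := (-1) :: List.replicate (k - 1) 0

/-- Thresholds justified entry by entry: either the elementary bound, or a pair of certified cuts `P_k ≥ -N⁺`, `P_k ≤ N⁻`
with `N⁺, N⁻ ≤ T_k`. -/
def ThresholdsValidX (d : ℕ) (B : ℝ) (T : List ℕ) : Prop :=
  ∀ k, 1 ≤ k → k ≤ T.length →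
    (2 * d - 2 : ℝ) + B ^ k + (B ^ k)⁻¹ ≤ (T.getD (k - 1) 0 : ℝ) + 1 ∨
    ∃ Np Nm : ℤ, Np ≤ T.getD (k - 1) 0 ∧ Nm ≤ T.getD (k - 1) 0 ∧
      CutValidAL d k B (unitCut k, Np) ∧ CutValidAL d k B (negUnitCut k, Nm)

/-- Elementary thresholds are valid in the extended sense. -/
theorem thresholdsValidX_of_valid {d : ℕ} {B : ℝ} {T : List ℕ} (h : ThresholdsValid d B T) : ThresholdsValidX d B T :=
  fun k hk1 hk2 => Or.inl (h k hk1 hk2)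

/-- `Σ (c • e_k) ⋅ ps = c · ps₀`. -/
theorem sum_zipWith_unit (c : ℤ) (m : ℕ) : ∀ ps : List ℤ,
    (List.zipWith (· * ·) (c :: List.replicate m 0) ps).sum = c * ps.getD 0 0
  | [] => by simp
  | x :: t => by
    rw [List.zipWith_cons_cons, List.sum_cons, List.getD_cons_zero]
    suffices h : (List.zipWith (· * ·) (List.replicate m (0 : ℤ)) t).sum = 0 by rw [h, add_zero]
    induction m generalizing t with
    | zero => simp
    | succ m ih => cases t with
      | nil => simp
      | cons y u => rw [List.replicate_succ, List.zipWith_cons_cons, List.sum_cons, zero_mul, zero_add, ih]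

/-- **Soundness of the search with a combined cut table and extended thresholds.** -/
theorem take_descCoeffList_mem_censusSearchC_of_irreducibleXT {p : ℤ[X]} {d : ℕ} (hd : 1 ≤ d) (hmonic : p.Monic)
    (hirr : Irreducible p) (hdeg : p.natDegree = 2 * d) (hpal : ∀ j ≤ 2 * d, p.coeff j = p.coeff (2 * d - j)) {B : ℝ}
    (hB : intMahlerMeasure p < B) {T : List ℕ} (hdT : d ≤ T.length) (hT : ThresholdsValidX d B T)
    {CT : List (List (List ℤ × ℤ))} (hCT : CutTableValidX d B CT) :
    (descCoeffList p).take d ∈ censusSearchC T CT d [] [] := by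
  apply mem_censusSearchC hdT _ (by rw [List.length_take, length_descCoeffList, hdeg]; omega)
  · intro k hk1 hk2
    rw [palC_take_descCoeffList hd hmonic hdeg hpal]
    set N := (psumsRev (descCoeffList p) k).getD 0 0
    rcases hT k hk1 hk2 with hTk | ⟨Np, Nm, hNp, hNm, hcp, hcm⟩
    · have hP := rec_even_powerSum_test p d hd hmonic hdeg hpal hB (k := k) (by omega)
      rw [← rootPowerSum_def, rootPowerSum_eq_head hmonic hk1, Complex.norm_intCast] at hP
      have h1 : (|N| : ℝ) < (T.getD (k - 1) 0 : ℝ) + 1 := lt_of_lt_of_le hP hTk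
      have h2 : |N| < (T.getD (k - 1) 0 : ℤ) + 1 := by exact_mod_cast h1
      have h3 : (N.natAbs : ℤ) ≤ (T.getD (k - 1) 0 : ℤ) := by rw [Int.natCast_natAbs]; omega
      exact_mod_cast h3
    · have hp := acutLog_holds hmonic hirr hdeg hpal hB hcp
      have hm := acutLog_holds hmonic hirr hdeg hpal hB hcm
      simp only [unitCut, negUnitCut] at hp hm
      rw [sum_zipWith_unit] at hp hm
      have h3 : (N.natAbs : ℤ) ≤ (T.getD (k - 1) 0 : ℤ) := by rw [Int.natCast_natAbs, abs_le]; constructor <;> omega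
      exact_mod_cast h3
  · intro k hk1 hk2 c hc
    rw [palC_take_descCoeffList hd hmonic hdeg hpal]
    exact cutX_holds hmonic hirr hdeg hpal hB (hCT k hk1 hk2 c hc)

/-- **Census verdict from certificates for `c₁ ≥ 0` only (combined cut table, extended thresholds).** -/
theorem census_verdict_nonnegXT {Bn Bd d : ℕ} {T : List ℕ} {CT : List (List (List ℤ × ℤ))} {L : List (List ℤ)}
    (hBd : 0 < Bd) (hd : 1 ≤ d) (hdT : d ≤ T.length) (hT : ThresholdsValidX d ((Bn : ℝ) / Bd) T)
    (hCT : CutTableValidX d ((Bn : ℝ) / Bd) CT)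
    (hcert : ∀ a ∈ censusSearchC T CT d [] [], 0 ≤ a.getD 0 0 →
      ∃ c, checkCert Bn Bd (2 * d) L (1 :: palC a) c = true)
    {p : ℤ[X]} (hmonic : p.Monic) (hdeg : p.natDegree = 2 * d)
    (hpal : ∀ j ≤ 2 * d, p.coeff j = p.coeff (2 * d - j)) (hirr : Irreducible p)
    (h1 : 1 < intMahlerMeasure p) (hB : intMahlerMeasure p < (Bn : ℝ) / Bd) :
    ∃ l ∈ L, p = ofCoeffs l ∨ p = (ofCoeffs l).comp (-X) := by
  have key : ∀ q : ℤ[X], q.Monic → q.natDegree = 2 * d → (∀ j ≤ 2 * d, q.coeff j = q.coeff (2 * d - j)) →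
      Irreducible q → 1 < intMahlerMeasure q → intMahlerMeasure q < (Bn : ℝ) / Bd → 0 ≤ q.coeff (2 * d - 1) →
      ∃ l ∈ L, q = ofCoeffs l ∨ q = (ofCoeffs l).comp (-X) := by
    intro q hqm hqd hqp hqi hq1 hqB hq0
    have hmem := take_descCoeffList_mem_censusSearchC_of_irreducibleXT hd hqm hqi hqd hqp hqB hdT hT hCT
    obtain ⟨c, hc⟩ := hcert _ hmem (by rw [getD_zero_take_descCoeffList hd hqd]; exact hq0)
    rw [palC_take_descCoeffList hd hqm hqd hqp] at hc
    have hp := eq_ofCoeffs_descCoeffList hqm hqd hqp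
    have hmon' : (ofCoeffs (1 :: descCoeffList q)).Monic := by rw [← hp]; exact hqm
    have hdeg' : (ofCoeffs (1 :: descCoeffList q)).natDegree = 2 * d := by rw [← hp]; exact hqd
    have hs := checkCert_sound hBd hc hmon' hdeg'
    rw [← hp] at hs
    rcases hs with h | h | h | h
    · rw [h] at hq1; exact absurd hq1 (lt_irrefl _)
    · exact absurd hqi h
    · exact absurd hqB (not_lt.mpr h.le)
    · exact h
  by_cases h0 : 0 ≤ p.coeff (2 * d - 1)
  · exact key p hmonic hdeg hpal hirr h1 hB h0
  · push Not at h0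
    obtain ⟨hqm, hqd, hqp, hqc⟩ := comp_neg_X_palindromic hd hmonic hdeg hpal
    have hq := key (p.comp (-X)) hqm hqd hqp (irreducible_comp_neg_X hirr)
      (by rw [intMahlerMeasure_comp_neg_X]; exact h1) (by rw [intMahlerMeasure_comp_neg_X]; exact hB)
      (by rw [hqc]; omega)
    obtain ⟨l, hl, h⟩ := hq
    refine ⟨l, hl, ?_⟩
    rcases h with h | h
    · right; rw [← h, comp_neg_X_comp_neg_X]
    · left
      have := congrArg (fun r : ℤ[X] => r.comp (-X)) h
      simpa only [comp_neg_X_comp_neg_X] using this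

/-- **From the halved kernel check (combined cuts, extended thresholds) to a census row** (`B = Bn/Bd ≤ θ₀`). -/
theorem degreeCensus_of_certified_nonnegXT {Bn Bd d : ℕ} {T : List ℕ} {CT : List (List (List ℤ × ℤ))}
    {L : List (List ℤ)} (hBd : 0 < Bd) (hd : 1 ≤ d) (hdT : d ≤ T.length) (hT : ThresholdsValidX d ((Bn : ℝ) / Bd) T)
    (hCT : CutTableValidX d ((Bn : ℝ) / Bd) CT) (hθ : (Bn : ℝ) / Bd ≤ smythTheta)
    (hcert : ∀ a ∈ censusSearchC T CT d [] [], 0 ≤ a.getD 0 0 →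
      ∃ c, checkCert Bn Bd (2 * d) L (1 :: palC a) c = true) :
    DegreeCensus (2 * d) ((Bn : ℝ) / Bd) L := by
  intro p hdeg hirr h1 h2
  have hrev := (reciprocal_of_measure_lt_smythTheta hirr h1 (lt_of_lt_of_le h2 hθ)).1
  have hlc : (|p.leadingCoeff| : ℝ) ≤ intMahlerMeasure p := abs_leadingCoeff_le_intMahlerMeasure p
  have hθ2 : smythTheta < 2 := by have := smythTheta_lt; linarith
  have hlc1 : p.leadingCoeff = 1 ∨ p.leadingCoeff = -1 := by
    have hne : p.leadingCoeff ≠ 0 := leadingCoeff_ne_zero.mpr hirr.ne_zero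
    have hle : |p.leadingCoeff| ≤ 1 := by
      by_contra h
      push Not at h
      have : (2 : ℝ) ≤ (|p.leadingCoeff| : ℝ) := by
        have : (2 : ℤ) ≤ |p.leadingCoeff| := h
        exact_mod_cast this
      linarith
    rcases abs_le.mp hle with ⟨h1', h2'⟩
    omega
  obtain ⟨hmonic, hpm, hMm, hdegm, hirrm⟩ := monic_normalisation hlc1
  set q := C p.leadingCoeff * p with hq
  have hrevq : q.reverse = q := by rw [hq, reverse_mul_of_domain, reverse_C, hrev]
  rw [hdeg] at hdegm
  have hpal := palindromic_of_reverse_eq_self q (2 * d) hdegm hrevq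
  rw [← hMm] at h1 h2
  obtain ⟨l, hl, hql⟩ := census_verdict_nonnegXT hBd hd hdT hT hCT hcert hmonic hdegm hpal (hirrm hirr) h1 h2
  refine ⟨l, hl, ?_⟩
  rcases hlc1 with hc | hc
  · have hpq : p = q := by rw [hpm, hc, C_1, one_mul]
    rcases hql with h | h
    · exact Or.inl (hpq.trans h)
    · exact Or.inr (Or.inr (Or.inl (hpq.trans h)))
  · have hpq : p = -q := by
      conv_lhs => rw [hpm, hc]
      simp
    rcases hql with h | h
    · exact Or.inr (Or.inl (by rw [hpq, h]))
    · exact Or.inr (Or.inr (Or.inr (by rw [hpq, h])))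

end Summit.Ventures.DiscreteObjects.Mahler
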